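import Mathlib
import HarnessLib
import Summits.Ventures.LatticeQCDFlow.Exactness.SU2WilsonFlowLOExactForceRegular

/-!
# THE WORK IDENTITY: along a drift `t ↦ exp(t·a)·V` the pulled-back action `S̃ = β·S_W∘F − log J` has derivative `κ⁻¹ Σ_l ⟪Φ_κ(exp(t·a)·V)_l, a_l⟫` — the exact force IS the gradient along the whole drift, not only at `t = 0` — hence `|κ|·|S̃(exp(a)·V) − S̃(V)| ≤ Φ_max · Σ_l ‖a_l‖`

HONEST FRAMING: exact (Metropolis-corrected) sampling algorithms for lattice gauge theory;
figures of merit are autocorrelation/cost numbers at stated couplings and volumes; no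
continuum-physics claim.

Venture `LatticeQCDFlow` (cell pub-lqcd), topic `Exactness`; FANOUT row 14 (`eng-flowhmc`, engine
`latflow.fthmc`, family B: the leapfrog drift `U_l ← expm(ε P_l) U_l` between two half kicks by the exact
autodiff force `Φ_κ`).  NEW WORK of the cell over the tree (`SU2WilsonFlowLOExactForceRegular` §2:
`su2WilsonFlowLO_exactForce_is_gradient` — at `a = 0` the differential of `a ↦ S̃(exp(a)·V)` is the pairing
with `Φ_κ(V)/κ`; Literature `B10Eq18SigmaSU2Chart.su2Coord_add/_smul`, Mathlib `Matrix.exp_add_of_commute`);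
nothing is cited as a fact; no number.  For ANY member given as `layers` (LO or learned), every `β, κ`:

* **`expPauli_add_smul`** — `exp(i(h+s)a·σ) = exp(iha·σ)·exp(isa·σ)` (parallel arguments commute), so the
  drift is a one-parameter group linkwise: **`su2Drift_add_smul`** `exp((h+s)p)·V = exp(hp)·(exp(sp)·V)`;
* **`hasDerivAt_ftAction_su2Drift`** — if `b ↦ S̃(exp(b)·W)` is differentiable at `b = 0` for every `W`
  (typed for the LO member in `SU2WilsonFlowLOContDiff` and for the learned member under (ρD) in
  `SU2ResidualExactForceCovering`), then for every `V`, `a`, `s`: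
  `d/dt|_{t=s} κ·S̃(exp(t·a)·V) = Σ_l ⟪Φ_κ(exp(s·a)·V)_l, a_l⟫` — THE WORK IDENTITY (the integrand of the
  energy change along the drift is the force read at the CURRENT configuration);
* **`abs_ftAction_su2Drift_sub_le`** — consequently, if `‖Φ_κ(W)_l‖ ≤ Φ_max` for all `W, l` then
  `|κ|·|S̃(exp(a)·V) − S̃(V)| ≤ Φ_max · Σ_l ‖a_l‖` (mean value along `t ∈ [0,1]`): the potential part of
  the leapfrog energy error over one drift of momenta `p` for time `ε` is at most `ε·Φ_max·Σ_l‖p_l‖/|κ|`.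

NOT CLAIMED: the second-order (trapezoid) energy-error bound and the resulting acceptance-vs-step-size
law (needs the Lipschitz constant `K_Φ` along the drift — the sequel); anything when `b ↦ S̃(exp(b)·W)` is
not differentiable (LeakyReLU conditioners); floating point; any number.
-/

noncomputable section

namespace Summit.Ventures.LatticeQCDFlow.Exactness

open Set Function MeasureTheory InnerProductGeometry WithLp NormedSpace
open Literature.MathematicalPhysics.QuantumFieldTheory
open Literature.MathematicalPhysics.QuantumFieldTheory.Balaban1983to89.B10Eq18SigmaSU2Haar (expPauli expPauli_zero coe_expPauli)
open Literature.MathematicalPhysics.QuantumFieldTheory.Balaban1983to89.B10Eq18SigmaSU2Chart (su2Coord_add su2Coord_smul)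
open scoped Matrix Matrix.Norms.Operator InnerProductSpace

set_option backward.isDefEq.respectTransparency false

/-! ## §1 The drift is a one-parameter group, link by link -/

section Group

/-- `exp(i(h+s)a·σ) = exp(iha·σ)·exp(isa·σ)`: parallel exponents commute. -/
theorem expPauli_add_smul (a : EuclideanSpace ℝ (Fin 3)) (h s : ℝ) :
    expPauli ((h + s) • a) = expPauli (h • a) * expPauli (s • a) := by
  apply Subtype.ext
  rw [WilsonFlow.coe_mul_SU, coe_expPauli, coe_expPauli, coe_expPauli]
  simp only [add_smul, WithLp.ofLp_add, WithLp.ofLp_smul, su2Coord_add, su2Coord_smul]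
  exact Matrix.exp_add_of_commute _ _ (((Commute.refl _).smul_left h).smul_right s)

variable {d L : ℕ}

/-- **The drift is a one-parameter group linkwise**: `exp((h+s)·a)·V = exp(h·a)·(exp(s·a)·V)`. -/
theorem su2Drift_add_smul (V : GaugeConfig d L (Matrix.specialUnitaryGroup (Fin 2) ℂ))
    (p : Edge d L → EuclideanSpace ℝ (Fin 3)) (h s : ℝ) :
    ((fun l : Edge d L => expPauli (((h + s) • p) l)) * V) =
      ((fun l : Edge d L => expPauli ((h • p) l)) * ((fun l : Edge d L => expPauli ((s • p) l)) * V)) := by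
  funext l
  simp only [Pi.mul_apply, Pi.smul_apply, expPauli_add_smul, mul_assoc]

end Group

/-! ## §2 The work identity and the mean-value bound -/

section Work

variable {d L : ℕ} [NeZero L]

/-- **THE WORK IDENTITY** — along the drift `t ↦ exp(t·p)·V` the derivative of `κ·S̃` at `t = s` is
`Σ_l ⟪Φ_κ(exp(s·p)·V)_l, p_l⟫`, for ANY member given as `layers` whose pulled-back action is differentiable
along every drift at zero momentum. -/
theorem hasDerivAt_ftAction_su2Drift
    (layers : List ((GaugeConfig d L (Matrix.specialUnitaryGroup (Fin 2) ℂ) ≃ᵐ GaugeConfig d L (Matrix.specialUnitaryGroup (Fin 2) ℂ)) × (GaugeConfig d L (Matrix.specialUnitaryGroup (Fin 2) ℂ) → ℝ)))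
    (β κ : ℝ)
    (hd : ∀ W : GaugeConfig d L (Matrix.specialUnitaryGroup (Fin 2) ℂ), DifferentiableAt ℝ (fun a : Edge d L → EuclideanSpace ℝ (Fin 3) => β * wilsonAction (Matrix.specialUnitaryGroup (Fin 2) ℂ).subtype ((layers.foldr (fun Ly (F : GaugeConfig d L (Matrix.specialUnitaryGroup (Fin 2) ℂ) ≃ᵐ GaugeConfig d L (Matrix.specialUnitaryGroup (Fin 2) ℂ)) => Ly.1.trans F) (MeasurableEquiv.refl (GaugeConfig d L (Matrix.specialUnitaryGroup (Fin 2) ℂ)))) ((fun l : Edge d L => expPauli (a l)) * W)) - Real.log ((layers.foldr (fun Ly K => fun v => Ly.2 v * K (Ly.1 v)) (fun _ => (1 : ℝ))) ((fun l : Edge d L => expPauli (a l)) * W))) 0)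
    (V : GaugeConfig d L (Matrix.specialUnitaryGroup (Fin 2) ℂ)) (p : Edge d L → EuclideanSpace ℝ (Fin 3)) (s : ℝ) :
    HasDerivAt (fun t : ℝ => κ * (fun a : Edge d L → EuclideanSpace ℝ (Fin 3) => β * wilsonAction (Matrix.specialUnitaryGroup (Fin 2) ℂ).subtype ((layers.foldr (fun Ly (F : GaugeConfig d L (Matrix.specialUnitaryGroup (Fin 2) ℂ) ≃ᵐ GaugeConfig d L (Matrix.specialUnitaryGroup (Fin 2) ℂ)) => Ly.1.trans F) (MeasurableEquiv.refl (GaugeConfig d L (Matrix.specialUnitaryGroup (Fin 2) ℂ)))) ((fun l : Edge d L => expPauli (a l)) * V)) - Real.log ((layers.foldr (fun Ly K => fun v => Ly.2 v * K (Ly.1 v)) (fun _ => (1 : ℝ))) ((fun l : Edge d L => expPauli (a l)) * V))) (t • p))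
      (∑ l, ⟪(fun (V : GaugeConfig d L (Matrix.specialUnitaryGroup (Fin 2) ℂ)) (l : Edge d L) => κ • WithLp.toLp 2 (fun i : Fin 3 =>
        fderiv ℝ (fun a : Edge d L → EuclideanSpace ℝ (Fin 3) => β * wilsonAction (Matrix.specialUnitaryGroup (Fin 2) ℂ).subtype ((layers.foldr (fun Ly (F : GaugeConfig d L (Matrix.specialUnitaryGroup (Fin 2) ℂ) ≃ᵐ GaugeConfig d L (Matrix.specialUnitaryGroup (Fin 2) ℂ)) => Ly.1.trans F) (MeasurableEquiv.refl (GaugeConfig d L (Matrix.specialUnitaryGroup (Fin 2) ℂ)))) ((fun l : Edge d L => expPauli (a l)) * V)) - Real.log ((layers.foldr (fun Ly K => fun v => Ly.2 v * K (Ly.1 v)) (fun _ => (1 : ℝ))) ((fun l : Edge d L => expPauli (a l)) * V))) 0 (Pi.single l (EuclideanSpace.single i (1 : ℝ))))) ((fun l : Edge d L => expPauli ((s • p) l)) * V) l, p l⟫_ℝ) s := by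
  -- chain rule at the current configuration `W = exp(s·p)·V`: inner map `t ↦ (t - s) • p`, outer map `b ↦ S̃(exp(b)·W)`
  have hinner : HasDerivAt (fun t : ℝ => (t - s) • p) p s := by
    simpa using ((hasDerivAt_id s).sub_const s).smul_const p
  have h0 : (fun t : ℝ => (t - s) • p) s = 0 := by simp
  have hG : HasFDerivAt (fun a : Edge d L → EuclideanSpace ℝ (Fin 3) => β * wilsonAction (Matrix.specialUnitaryGroup (Fin 2) ℂ).subtype ((layers.foldr (fun Ly (F : GaugeConfig d L (Matrix.specialUnitaryGroup (Fin 2) ℂ) ≃ᵐ GaugeConfig d L (Matrix.specialUnitaryGroup (Fin 2) ℂ)) => Ly.1.trans F) (MeasurableEquiv.refl (GaugeConfig d L (Matrix.specialUnitaryGroup (Fin 2) ℂ)))) ((fun l : Edge d L => expPauli (a l)) * ((fun l : Edge d L => expPauli ((s • p) l)) * V))) - Real.log ((layers.foldr (fun Ly K => fun v => Ly.2 v * K (Ly.1 v)) (fun _ => (1 : ℝ))) ((fun l : Edge d L => expPauli (a l)) * ((fun l : Edge d L => expPauli ((s • p) l)) * V)))) (fderiv ℝ (fun a : Edge d L → EuclideanSpace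 ℝ (Fin 3) => β * wilsonAction (Matrix.specialUnitaryGroup (Fin 2) ℂ).subtype ((layers.foldr (fun Ly (F : GaugeConfig d L (Matrix.specialUnitaryGroup (Fin 2) ℂ) ≃ᵐ GaugeConfig d L (Matrix.specialUnitaryGroup (Fin 2) ℂ)) => Ly.1.trans F) (MeasurableEquiv.refl (GaugeConfig d L (Matrix.specialUnitaryGroup (Fin 2) ℂ)))) ((fun l : Edge d L => expPauli (a l)) * ((fun l : Edge d L => expPauli ((s • p) l)) * V))) - Real.log ((layers.foldr (fun Ly K => fun v => Ly.2 v * K (Ly.1 v)) (fun _ => (1 : ℝ))) ((fun l : Edge d L => expPauli (a l)) * ((fun l : Edge d L => expPauli ((s • p) l)) * V)))) 0) ((fun t : ℝ => (t - s) • p) s) := by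
    rw [h0]
    exact (hd _).hasFDerivAt
  have hfin := (hG.comp_hasDerivAt s hinner).const_mul κ
  rw [su2WilsonFlowLO_exactForce_is_gradient layers β κ ((fun l : Edge d L => expPauli ((s • p) l)) * V) p] at hfin
  have hfeq : (fun t : ℝ => κ * (fun a : Edge d L → EuclideanSpace ℝ (Fin 3) => β * wilsonAction (Matrix.specialUnitaryGroup (Fin 2) ℂ).subtype ((layers.foldr (fun Ly (F : GaugeConfig d L (Matrix.specialUnitaryGroup (Fin 2) ℂ) ≃ᵐ GaugeConfig d L (Matrix.specialUnitaryGroup (Fin 2) ℂ)) => Ly.1.trans F) (MeasurableEquiv.refl (GaugeConfig d L (Matrix.specialUnitaryGroup (Fin 2) ℂ)))) ((fun l : Edge d L => expPauli (a l)) * V)) - Real.log ((layers.foldr (fun Ly K => fun v => Ly.2 v * K (Ly.1 v)) (fun _ => (1 : ℝ))) ((fun l : Edge d L => expPauli (a l)) * V))) (t • p)) =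
      fun y : ℝ => κ * (((fun a : Edge d L → EuclideanSpace ℝ (Fin 3) => β * wilsonAction (Matrix.specialUnitaryGroup (Fin 2) ℂ).subtype ((layers.foldr (fun Ly (F : GaugeConfig d L (Matrix.specialUnitaryGroup (Fin 2) ℂ) ≃ᵐ GaugeConfig d L (Matrix.specialUnitaryGroup (Fin 2) ℂ)) => Ly.1.trans F) (MeasurableEquiv.refl (GaugeConfig d L (Matrix.specialUnitaryGroup (Fin 2) ℂ)))) ((fun l : Edge d L => expPauli (a l)) * ((fun l : Edge d L => expPauli ((s • p) l)) * V))) - Real.log ((layers.foldr (fun Ly K => fun v => Ly.2 v * K (Ly.1 v)) (fun _ => (1 : ℝ))) ((fun l : Edge d L => expPauli (a l)) * ((fun l : Edge d L => expPauli ((s • p) l)) * V))))) ∘ fun t : ℝ => (t - s) • p) y := by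
    funext t
    simp only [Function.comp_apply]
    rw [← su2Drift_add_smul V p (t - s) s, sub_add_cancel]
  rw [hfeq]
  exact hfin

/-- **THE MEAN-VALUE BOUND ALONG A DRIFT**: with `‖Φ_κ(W)_l‖ ≤ Φ_max` everywhere,
`|κ|·|S̃(exp(p)·V) − S̃(V)| ≤ Φ_max · Σ_l ‖p_l‖`. -/
theorem abs_ftAction_su2Drift_sub_le
    (layers : List ((GaugeConfig d L (Matrix.specialUnitaryGroup (Fin 2) ℂ) ≃ᵐ GaugeConfig d L (Matrix.specialUnitaryGroup (Fin 2) ℂ)) × (GaugeConfig d L (Matrix.specialUnitaryGroup (Fin 2) ℂ) → ℝ)))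
    (β κ : ℝ)
    (hd : ∀ W : GaugeConfig d L (Matrix.specialUnitaryGroup (Fin 2) ℂ), DifferentiableAt ℝ (fun a : Edge d L → EuclideanSpace ℝ (Fin 3) => β * wilsonAction (Matrix.specialUnitaryGroup (Fin 2) ℂ).subtype ((layers.foldr (fun Ly (F : GaugeConfig d L (Matrix.specialUnitaryGroup (Fin 2) ℂ) ≃ᵐ GaugeConfig d L (Matrix.specialUnitaryGroup (Fin 2) ℂ)) => Ly.1.trans F) (MeasurableEquiv.refl (GaugeConfig d L (Matrix.specialUnitaryGroup (Fin 2) ℂ)))) ((fun l : Edge d L => expPauli (a l)) * W)) - Real.log ((layers.foldr (fun Ly K => fun v => Ly.2 v * K (Ly.1 v)) (fun _ => (1 : ℝ))) ((fun l : Edge d L => expPauli (a l)) * W))) 0)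
    {Φmax : ℝ} (hΦ : ∀ (W : GaugeConfig d L (Matrix.specialUnitaryGroup (Fin 2) ℂ)) (l : Edge d L), ‖(fun (V : GaugeConfig d L (Matrix.specialUnitaryGroup (Fin 2) ℂ)) (l : Edge d L) => κ • WithLp.toLp 2 (fun i : Fin 3 =>
        fderiv ℝ (fun a : Edge d L → EuclideanSpace ℝ (Fin 3) => β * wilsonAction (Matrix.specialUnitaryGroup (Fin 2) ℂ).subtype ((layers.foldr (fun Ly (F : GaugeConfig d L (Matrix.specialUnitaryGroup (Fin 2) ℂ) ≃ᵐ GaugeConfig d L (Matrix.specialUnitaryGroup (Fin 2) ℂ)) => Ly.1.trans F) (MeasurableEquiv.refl (GaugeConfig d L (Matrix.specialUnitaryGroup (Fin 2) ℂ)))) ((fun l : Edge d L => expPauli (a l)) * V)) - Real.log ((layers.foldr (fun Ly K => fun v => Ly.2 v * K (Ly.1 v)) (fun _ => (1 : ℝ))) ((fun l : Edge d L => expPauli (a l)) * V))) 0 (Pi.single l (EuclideanSpace.single i (1 : ℝ))))) W l‖ ≤ Φmax)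
    (V : GaugeConfig d L (Matrix.specialUnitaryGroup (Fin 2) ℂ)) (p : Edge d L → EuclideanSpace ℝ (Fin 3)) :
    |κ| * |(fun a : Edge d L → EuclideanSpace ℝ (Fin 3) => β * wilsonAction (Matrix.specialUnitaryGroup (Fin 2) ℂ).subtype ((layers.foldr (fun Ly (F : GaugeConfig d L (Matrix.specialUnitaryGroup (Fin 2) ℂ) ≃ᵐ GaugeConfig d L (Matrix.specialUnitaryGroup (Fin 2) ℂ)) => Ly.1.trans F) (MeasurableEquiv.refl (GaugeConfig d L (Matrix.specialUnitaryGroup (Fin 2) ℂ)))) ((fun l : Edge d L => expPauli (a l)) * V)) - Real.log ((layers.foldr (fun Ly K => fun v => Ly.2 v * K (Ly.1 v)) (fun _ => (1 : ℝ))) ((fun l : Edge d L => expPauli (a l)) * V))) p - (fun a : Edge d L → EuclideanSpace ℝ (Fin 3) => β * wilsonAction (Matrix.specialUnitaryGroup (Fin 2) ℂ).subtype ((layers.foldr (fun Ly (F : GaugeConfig d L (Matrix.specialUnitaryGroup (Fin 2) ℂ) ≃ᵐ GaugeConfig d L (Matrix.specialUnitaryGroup (Fin 2) ℂ)) => Ly.1.trans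 F) (MeasurableEquiv.refl (GaugeConfig d L (Matrix.specialUnitaryGroup (Fin 2) ℂ)))) ((fun l : Edge d L => expPauli (a l)) * V)) - Real.log ((layers.foldr (fun Ly K => fun v => Ly.2 v * K (Ly.1 v)) (fun _ => (1 : ℝ))) ((fun l : Edge d L => expPauli (a l)) * V))) 0| ≤ Φmax * ∑ l, ‖p l‖ := by
  have hderiv : ∀ t ∈ Icc (0 : ℝ) 1, HasDerivWithinAt (fun t : ℝ => κ * (fun a : Edge d L → EuclideanSpace ℝ (Fin 3) => β * wilsonAction (Matrix.specialUnitaryGroup (Fin 2) ℂ).subtype ((layers.foldr (fun Ly (F : GaugeConfig d L (Matrix.specialUnitaryGroup (Fin 2) ℂ) ≃ᵐ GaugeConfig d L (Matrix.specialUnitaryGroup (Fin 2) ℂ)) => Ly.1.trans F) (MeasurableEquiv.refl (GaugeConfig d L (Matrix.specialUnitaryGroup (Fin 2) ℂ)))) ((fun l : Edge d L => expPauli (a l)) * V)) - Real.log ((layers.foldr (fun Ly K => fun v => Ly.2 v * K (Ly.1 v)) (fun _ => (1 : ℝ))) ((fun l : Edge d L => expPauli (a l)) * V))) (t • p))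
      ((fun t : ℝ => ∑ l, ⟪(fun (V : GaugeConfig d L (Matrix.specialUnitaryGroup (Fin 2) ℂ)) (l : Edge d L) => κ • WithLp.toLp 2 (fun i : Fin 3 =>
        fderiv ℝ (fun a : Edge d L → EuclideanSpace ℝ (Fin 3) => β * wilsonAction (Matrix.specialUnitaryGroup (Fin 2) ℂ).subtype ((layers.foldr (fun Ly (F : GaugeConfig d L (Matrix.specialUnitaryGroup (Fin 2) ℂ) ≃ᵐ GaugeConfig d L (Matrix.specialUnitaryGroup (Fin 2) ℂ)) => Ly.1.trans F) (MeasurableEquiv.refl (GaugeConfig d L (Matrix.specialUnitaryGroup (Fin 2) ℂ)))) ((fun l : Edge d L => expPauli (a l)) * V)) - Real.log ((layers.foldr (fun Ly K => fun v => Ly.2 v * K (Ly.1 v)) (fun _ => (1 : ℝ))) ((fun l : Edge d L => expPauli (a l)) * V))) 0 (Pi.single l (EuclideanSpace.single i (1 : ℝ))))) ((fun l : Edge d L => expPauli ((t • p) l)) * V) l, p l⟫_ℝ) t) (Icc (0 : ℝ) 1) t :=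
    fun t _ => (hasDerivAt_ftAction_su2Drift layers β κ hd V p t).hasDerivWithinAt
  have hbound : ∀ t ∈ Ico (0 : ℝ) 1, ‖(fun t : ℝ => ∑ l, ⟪(fun (V : GaugeConfig d L (Matrix.specialUnitaryGroup (Fin 2) ℂ)) (l : Edge d L) => κ • WithLp.toLp 2 (fun i : Fin 3 =>
        fderiv ℝ (fun a : Edge d L → EuclideanSpace ℝ (Fin 3) => β * wilsonAction (Matrix.specialUnitaryGroup (Fin 2) ℂ).subtype ((layers.foldr (fun Ly (F : GaugeConfig d L (Matrix.specialUnitaryGroup (Fin 2) ℂ) ≃ᵐ GaugeConfig d L (Matrix.specialUnitaryGroup (Fin 2) ℂ)) => Ly.1.trans F) (MeasurableEquiv.refl (GaugeConfig d L (Matrix.specialUnitaryGroup (Fin 2) ℂ)))) ((fun l : Edge d L => expPauli (a l)) * V)) - Real.log ((layers.foldr (fun Ly K => fun v => Ly.2 v * K (Ly.1 v)) (fun _ => (1 : ℝ))) ((fun l : Edge d L => expPauli (a l)) * V))) 0 (Pi.single l (EuclideanSpace.single i (1 : ℝ))))) ((fun l : Edge d L => expPauli ((t • p) l)) * V) l,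 p l⟫_ℝ) t‖ ≤ Φmax * ∑ l, ‖p l‖ := by
    intro t _
    refine (norm_sum_le _ _).trans ?_
    rw [Finset.mul_sum]
    refine Finset.sum_le_sum fun l _ => ?_
    exact (norm_inner_le_norm _ _).trans (mul_le_mul_of_nonneg_right (hΦ _ l) (norm_nonneg _))
  have h := norm_image_sub_le_of_norm_deriv_le_segment' hderiv hbound 1 (right_mem_Icc.2 zero_le_one)
  simp only [one_smul, zero_smul, sub_zero, mul_one] at h
  rw [← mul_sub, norm_mul, Real.norm_eq_abs, Real.norm_eq_abs] at h
  exact h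

end Work

end Summit.Ventures.LatticeQCDFlow.Exactness
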